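import Literature.Probability.Percolation.InequalitiesProofs
import HarnessLib

/-!
# Joint occurrence of increasing events decreases under partial privatisation (Goldstein–Rinott 2007, Thm. 4.1)

Topic `Literature/Probability/LatticeModels`. Source: L. Goldstein, Y. Rinott, *Functional BKR
inequalities, and their duals, with applications*, J. Theor. Probab. 20 (2007) 275–293, §4
"A PQD ordering inequality", **Theorem 4.1** and Corollary 4.1 [GoldsteinRinott2007]; read in the
2015 arXiv revision arXiv:1508.07267, p. 12 (held) [GoldsteinRinott2015].

**Printed statement** (p. 12): `X = (X_1, …, X_n)` a vector of independent random variables, `Y` an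
independent copy of `X`, `f_α` (`α = 1, …, m`) functions "which are all increasing or all decreasing
in each component", `H_α ⊆ [n]`, `Z_α := (Y_i` if `i ∈ H_α`, `X_i` if `i ∉ H_α)`,
`R = (f_1(Z_1), …, f_m(Z_m))`, `S = (f_1(X), …, f_m(X))`: "**Theorem 4.1.** For every
`c = (c_1, …, c_m) ∈ ℝ^m` and `H_α ⊆ n`, `α = 1, …, m`, `P(R ≥ c) ≤ P(S ≥ c)` and
`P(R ≤ c) ≤ P(S ≤ c)`" ("the components of `R` are more Positively Quadrant Dependent than those of
`S`"); "**Corollary 4.1.** For all `c ∈ ℝ`, `P(max_α f_α(Z_α) ≤ c) ≤ P(max_α f_α(X) ≤ c)`".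
Printed proof (half a page): induction on the number `k` of coordinates already privatised; at the
new coordinate `k+1`, conditionally on everything else, the events of the functions with
`k+1 ∈ H_α` and of those with `k+1 ∉ H_α` are increasing in two different copies of the same
variable, "the product of (conditional) expectations of two increasing functions of `X_{k+1}`,
which is smaller than the (conditional) expectation of the product" (Harris on one coordinate).

We transcribe the EVENT form (`c_α`-superlevel sets of increasing functions = increasing events) on
the weighted cube of the tree's `bk_inequality_cube`: finite coordinate type `α`, product weight
`W(x) = ∏ᵢ wᵢ(xᵢ)` with `wᵢ ≥ 0`, increasing events `A j` (`j : κ`, any index type) with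
privatisation sets `H j ⊆ α`, two copies `(x, y)` with weight `W(x) W(y)`:
`(W ⊗ W)(∀ j, mix_{H j}(x, y) ∈ A j) ≤ W(Γ) · W(⋂_j A j)` (`GoldsteinRinott2007.pqd_cube`), where
`mix_H(x, y)` reads `y` on `H` and `x` off `H`. The proof is the printed induction run as a chain over
the set `S` of privatised coordinates on the tree's two-copy machinery (`bkCube_sum_pair_split`,
`bkCube_prod_update`); the one-coordinate step is the two-point Harris (Chebyshev) inequality
`two_point_harris`. With all `H j = univ` but one and pairwise "disjointly read" events this
interpolates Harris's inequality `∏ W(A j) W(Γ)^{…} ≤ …`; the chain is the same mechanism as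
Grimmett's coupling proof of BK (`bkCube_sum_mono`) and Baron–Kahn's privatisation proof
(`BaronKahn2019.hybrid_sum_mono`).

Not transcribed: the decreasing case and `P(R ≤ c) ≤ P(S ≤ c)` (the same proof with lower sets),
general (non-binary) independent coordinates, Corollary 4.1 (the special case of equal events).
-/

namespace Literature.Probability.LatticeModels

namespace GoldsteinRinott2007

open Finset Function

variable {α : Type*} [Fintype α] [DecidableEq α] {κ : Type*}

/-- The mixed configuration `Z_H`: the copy `y` on the privatised coordinates `H`, the copy `x`
elsewhere. [cite: GoldsteinRinott2007, §4 (the vectors Z_α)] -/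
def mix (H : Finset α) (x y : α → Bool) : α → Bool := fun i => if i ∈ H then y i else x i

omit [Fintype α] in
/-- `mix` over the empty set is the shared copy. [folklore] -/
@[simp] theorem mix_empty (x y : α → Bool) : mix ∅ x y = x := by
  funext i; simp [mix]

/-- **The chain events**: all events hold, event `j` reading `y` on `H j ∩ S` and `x` elsewhere
(the printed `Z_α^k` with `H_α^k = H_α ∩ {1, …, k}`). [cite: GoldsteinRinott2007, §4 (proof of Thm. 4.1, the vectors Z^k_α)] -/
def chainEvent (A : κ → Set (α → Bool)) (H : κ → Finset α) (S : Finset α) :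
    Set ((α → Bool) × (α → Bool)) :=
  {xy | ∀ j, mix (H j ∩ S) xy.1 xy.2 ∈ A j}

omit [Fintype α] in
/-- Membership in the chain event. [cite: GoldsteinRinott2007, §4] -/
theorem mem_chainEvent {A : κ → Set (α → Bool)} {H : κ → Finset α} {S : Finset α}
    {xy : (α → Bool) × (α → Bool)} :
    xy ∈ chainEvent A H S ↔ ∀ j, mix (H j ∩ S) xy.1 xy.2 ∈ A j := Iff.rfl

/-- **Harris's inequality on two points** (Chebyshev's sum inequality): for weights `w ≥ 0` and
`u, v : Bool → ℝ` monotone in the same direction (`u false ≤ u true`, `v false ≤ v true`),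
`(Σ_b w_b u_b)(Σ_c w_c v_c) ≤ (Σ_b w_b)(Σ_b w_b u_b v_b)` — "the product of expectations of two
increasing functions of `X_{k+1}` … is smaller than the expectation of the product".
[cite: GoldsteinRinott2007, §4 (proof of Thm. 4.1, last step)] -/
theorem two_point_harris {w u v : Bool → ℝ} (hw : ∀ b, 0 ≤ w b) (hu : u false ≤ u true)
    (hv : v false ≤ v true) :
    (∑ b, w b * u b) * (∑ c, w c * v c) ≤ (∑ b, w b) * ∑ b, w b * (u b * v b) := by
  simp only [Fintype.sum_bool]
  nlinarith [mul_nonneg (hw true) (hw false), mul_nonneg (mul_nonneg (hw true) (hw false))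
    (mul_nonneg (sub_nonneg.2 hu) (sub_nonneg.2 hv))]

/-- **The one-coordinate step** (the printed induction step `P(S^{k+1} ≥ c) ≤ P(S^k ≥ c)`):
privatising one more coordinate `k ∉ S` does not increase the weight of the chain event. Conditionally
on all other bits, the events with `k ∈ H j` and those with `k ∉ H j` are increasing in the two bits
at `k`, of equal weight, and `two_point_harris` applies. [cite: GoldsteinRinott2007, Thm. 4.1 (proof)] -/
theorem chain_sum_anti (w : α → Bool → ℝ) (hw : ∀ i b, 0 ≤ w i b) {A : κ → Set (α → Bool)}
    (hA : ∀ j, IsUpperSet (A j)) (H : κ → Finset α) {S : Finset α} {k : α} (hk : k ∉ S) :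
    ∑ xy, (chainEvent A H (insert k S)).indicator
        (fun xy : (α → Bool) × (α → Bool) => (∏ i, w i (xy.1 i)) * ∏ i, w i (xy.2 i)) xy ≤
      ∑ xy, (chainEvent A H S).indicator
        (fun xy : (α → Bool) × (α → Bool) => (∏ i, w i (xy.1 i)) * ∏ i, w i (xy.2 i)) xy := by
  classical
  rw [Literature.Probability.Percolation.bkCube_sum_pair_split k,
    Literature.Probability.Percolation.bkCube_sum_pair_split k ((chainEvent A H S).indicator _)]
  refine Finset.sum_le_sum fun xy _ => ?_
  split_ifs with hxy
  · obtain ⟨x, y⟩ := xy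
    set m : ℝ := (∏ i ∈ univ.erase k, w i (x i)) * ∏ i ∈ univ.erase k, w i (y i) with hm_def
    have hm : 0 ≤ m :=
      mul_nonneg (Finset.prod_nonneg fun i _ => hw i _) (Finset.prod_nonneg fun i _ => hw i _)
    have hval : ∀ b c : Bool, (∏ i, w i (update x k b i)) * ∏ i, w i (update y k c i) =
        w k b * w k c * m := by
      intro b c
      rw [Literature.Probability.Percolation.bkCube_prod_update,
        Literature.Probability.Percolation.bkCube_prod_update, hm_def]
      ring
    -- the two groups of events, as functions of the bit they read at `k`
    let U : Bool → Prop := fun b => ∀ j, k ∉ H j → mix (H j ∩ S) (update x k b) (update y k b) ∈ A j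
    let V : Bool → Prop := fun c => ∀ j, k ∈ H j → mix (H j ∩ S) (update x k c) (update y k c) ∈ A j
    -- reading lemmas: what the mixed configurations are at the two stages
    have hmixS : ∀ (j : κ) (b c : Bool), mix (H j ∩ S) (update x k b) (update y k c) =
        mix (H j ∩ S) (update x k b) (update y k b) := by
      intro j b c
      funext i
      by_cases hi : i = k
      · subst hi
        simp [mix, hk]
      · simp [mix, update_of_ne hi]
    have hmixI_in : ∀ (j : κ) (b c : Bool), k ∈ H j →
        mix (H j ∩ insert k S) (update x k b) (update y k c) =
          mix (H j ∩ S) (update x k c) (update y k c) := by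
      intro j b c hj
      funext i
      by_cases hi : i = k
      · subst hi
        simp [mix, hj]
      · simp [mix, hi]
    have hmixI_out : ∀ (j : κ) (b c : Bool), k ∉ H j →
        mix (H j ∩ insert k S) (update x k b) (update y k c) =
          mix (H j ∩ S) (update x k b) (update y k b) := by
      intro j b c hj
      funext i
      by_cases hi : i = k
      · subst hi
        simp [mix, hj]
      · simp [mix, hi]
    have hS : ∀ b c : Bool, (update x k b, update y k c) ∈ chainEvent A H S ↔ U b ∧ V b := by
      intro b c
      rw [mem_chainEvent]
      constructor
      · intro h
        exact ⟨fun j _ => (hmixS j b c) ▸ h j, fun j _ => (hmixS j b c) ▸ h j⟩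
      · rintro ⟨hU, hV⟩ j
        rw [hmixS j b c]
        by_cases hj : k ∈ H j
        · exact hV j hj
        · exact hU j hj
    have hI : ∀ b c : Bool, (update x k b, update y k c) ∈ chainEvent A H (insert k S) ↔
        U b ∧ V c := by
      intro b c
      rw [mem_chainEvent]
      constructor
      · intro h
        refine ⟨fun j hj => ?_, fun j hj => ?_⟩
        · have := h j; rwa [hmixI_out j b c hj] at this
        · have := h j; rwa [hmixI_in j b c hj] at this
      · rintro ⟨hU, hV⟩ j
        by_cases hj : k ∈ H j
        · rw [hmixI_in j b c hj]; exact hV j hj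
        · rw [hmixI_out j b c hj]; exact hU j hj
    -- monotonicity of the two groups in their bit
    have hmix_mono : ∀ (T : Finset α) (b b' : Bool), b ≤ b' →
        mix T (update x k b) (update y k b) ≤ mix T (update x k b') (update y k b') := by
      intro T b b' hbb' i
      by_cases hi : i = k
      · subst hi
        simp only [mix, update_self]
        split_ifs <;> exact hbb'
      · simp [mix, update_of_ne hi]
    have hUmono : U false → U true := fun h j hj =>
      hA j (hmix_mono _ false true (by decide)) (h j hj)
    have hVmono : V false → V true := fun h j hj =>
      hA j (hmix_mono _ false true (by decide)) (h j hj)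
    -- numerical form
    let u : Bool → ℝ := fun b => if U b then 1 else 0
    let v : Bool → ℝ := fun c => if V c then 1 else 0
    have hu : u false ≤ u true := by
      simp only [u]
      split_ifs with h1 h2 <;> first | exact le_rfl | exact zero_le_one | exact absurd (hUmono h1) h2
    have hv : v false ≤ v true := by
      simp only [v]
      split_ifs with h1 h2 <;> first | exact le_rfl | exact zero_le_one | exact absurd (hVmono h1) h2
    have hL : ∀ b c : Bool, (chainEvent A H (insert k S)).indicator
        (fun xy : (α → Bool) × (α → Bool) => (∏ i, w i (xy.1 i)) * ∏ i, w i (xy.2 i))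
        (update x k b, update y k c) = w k b * u b * (w k c * v c) * m := by
      intro b c
      by_cases h : (update x k b, update y k c) ∈ chainEvent A H (insert k S)
      · obtain ⟨h1, h2⟩ := (hI b c).1 h
        rw [Set.indicator_of_mem h, hval]
        simp [u, v, h1, h2]
      · rw [Set.indicator_of_notMem h]
        have : ¬ (U b ∧ V c) := fun h' => h ((hI b c).2 h')
        by_cases h1 : U b
        · have h2 : ¬ V c := fun h2 => this ⟨h1, h2⟩
          simp [u, v, h2]
        · simp [u, h1]
    have hR : ∀ b c : Bool, (chainEvent A H S).indicator
        (fun xy : (α → Bool) × (α → Bool) => (∏ i, w i (xy.1 i)) * ∏ i, w i (xy.2 i))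
        (update x k b, update y k c) = w k b * (u b * v b) * w k c * m := by
      intro b c
      by_cases h : (update x k b, update y k c) ∈ chainEvent A H S
      · obtain ⟨h1, h2⟩ := (hS b c).1 h
        rw [Set.indicator_of_mem h, hval]
        simp [u, v, h1, h2]
      · rw [Set.indicator_of_notMem h]
        have : ¬ (U b ∧ V b) := fun h' => h ((hS b c).2 h')
        by_cases h1 : U b
        · have h2 : ¬ V b := fun h2 => this ⟨h1, h2⟩
          simp [u, v, h2]
        · simp [u, h1]
    simp_rw [hL, hR]
    have key := two_point_harris (w := w k) (u := u) (v := v) (hw k) hu hv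
    calc ∑ b, ∑ c, w k b * u b * (w k c * v c) * m
        = ((∑ b, w k b * u b) * ∑ c, w k c * v c) * m := by
          rw [Finset.sum_mul_sum, Finset.sum_mul]
          refine Finset.sum_congr rfl fun b _ => ?_
          rw [Finset.sum_mul]
      _ ≤ ((∑ b, w k b) * ∑ b, w k b * (u b * v b)) * m :=
          mul_le_mul_of_nonneg_right key hm
      _ = ∑ b, ∑ c, w k b * (u b * v b) * w k c * m := by
          rw [mul_comm (∑ b, w k b) _, Finset.sum_mul_sum, Finset.sum_mul]
          refine Finset.sum_congr rfl fun b _ => ?_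
          rw [Finset.sum_mul]
  · exact le_rfl

/-- Iterating the step from `S` down to `∅`. [cite: GoldsteinRinott2007, Thm. 4.1 (proof, induction on k)] -/
theorem chain_sum_le_empty (w : α → Bool → ℝ) (hw : ∀ i b, 0 ≤ w i b) {A : κ → Set (α → Bool)}
    (hA : ∀ j, IsUpperSet (A j)) (H : κ → Finset α) (S : Finset α) :
    ∑ xy, (chainEvent A H S).indicator
        (fun xy : (α → Bool) × (α → Bool) => (∏ i, w i (xy.1 i)) * ∏ i, w i (xy.2 i)) xy ≤
      ∑ xy, (chainEvent A H ∅).indicator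
        (fun xy : (α → Bool) × (α → Bool) => (∏ i, w i (xy.1 i)) * ∏ i, w i (xy.2 i)) xy := by
  induction S using Finset.induction_on with
  | empty => exact le_rfl
  | insert k S hk ih => exact (chain_sum_anti w hw hA H hk).trans ih

/-- **Goldstein–Rinott 2007, Thm. 4.1 (first inequality), event form on the weighted cube.** For
`α` finite, a product weight `W(x) = ∏ᵢ wᵢ(xᵢ)` with `wᵢ ≥ 0`, increasing events `A j` (`j : κ`) and
privatisation sets `H j ⊆ α`: on two copies `(x, y)` with weight `W(x) W(y)`,
`(W ⊗ W){∀ j, mix_{H j}(x, y) ∈ A j} ≤ W(Γ) · W(⋂_j A j)` — reading some coordinates of some of the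
events in an independent copy can only decrease the probability that all the events occur
(`P(R ≥ c) ≤ P(S ≥ c)`). [cite: GoldsteinRinott2007, Thm. 4.1] -/
theorem pqd_cube (w : α → Bool → ℝ) (hw : ∀ i b, 0 ≤ w i b) {A : κ → Set (α → Bool)}
    (hA : ∀ j, IsUpperSet (A j)) (H : κ → Finset α) :
    ∑ xy, {xy : (α → Bool) × (α → Bool) | ∀ j, mix (H j) xy.1 xy.2 ∈ A j}.indicator
        (fun xy => (∏ i, w i (xy.1 i)) * ∏ i, w i (xy.2 i)) xy ≤
      (∑ x : α → Bool, ∏ i, w i (x i)) *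
        ∑ x, {x : α → Bool | ∀ j, x ∈ A j}.indicator (fun x => ∏ i, w i (x i)) x := by
  classical
  have key := chain_sum_le_empty w hw hA H Finset.univ
  have hl : chainEvent A H Finset.univ =
      {xy : (α → Bool) × (α → Bool) | ∀ j, mix (H j) xy.1 xy.2 ∈ A j} := by
    ext xy
    simp [mem_chainEvent]
  have hr : ∑ xy, (chainEvent A H ∅).indicator
      (fun xy : (α → Bool) × (α → Bool) => (∏ i, w i (xy.1 i)) * ∏ i, w i (xy.2 i)) xy =
      (∑ x : α → Bool, ∏ i, w i (x i)) *
        ∑ x, {x : α → Bool | ∀ j, x ∈ A j}.indicator (fun x => ∏ i, w i (x i)) x := by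
    rw [mul_comm, Fintype.sum_prod_type, Finset.sum_mul]
    refine Finset.sum_congr rfl fun x _ => ?_
    rw [Finset.mul_sum]
    refine Finset.sum_congr rfl fun y _ => ?_
    have hiff : (x, y) ∈ chainEvent A H ∅ ↔ x ∈ {x : α → Bool | ∀ j, x ∈ A j} := by
      simp [mem_chainEvent]
    simp only [Set.indicator_apply, hiff]
    split_ifs <;> simp
  rw [hl, hr] at key
  exact key

end GoldsteinRinott2007

end Literature.Probability.LatticeModels
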